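import Literature.Computability.MetaComplexity.SamplableMixtures
import Literature.Computability.Complexity.BPPErrorReductionStrong

/-!
# Route SzkEntropy, crux `PeaWorstToAvg` (stmt-PneNP-10777), line `dual-mode-compile`, stub `stub_adviceElim`:
# the labelled self-testing experiment (definitions and structural lemmas)

Support file for the stub `stub_adviceElim` of the skeleton
`Summits/PneNP/PneNP/Cruxes/PeaWorstToAvg/Lines/dual-mode-compile.lean` (advice elimination by labelled
self-testing).  In the tree's model of probabilistic machines (`RandAlg`, `Complexity/Randomized.lean`) the
coin budget `coinLen` of a heuristic scheme `A(x, 1ⁿ, 1ᵐ)` (`HeurBPP`) is an arbitrary polynomially bounded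
function of the input length — `O(log)` bits of advice.  A UNIFORM scheme `U` (honest polynomial budget)
simulating `A` cannot compute the budget; instead it

* pads the failure parameter of every query `y'` to `m'(y') = G − |⟨y', 1ⁿ, 1⁰⟩|` (`padM`, `query`), so that
  all queries have the same length `G` and hence ONE unknown budget `c⋆ = coinLen_A G ≤ P`;
* for every candidate budget `c ≤ P` forms the majority vote `maj` of `k` runs of `A` reading `c` coins each
  (`votes`, `maj`);
* tests every candidate on `N` fresh LABELLED samples — a sample block `b · r · Z` gives the label `b`, the
  instance `S_b(1ⁿ; r)` of the uniform sampler `S_b` (`inst`) and amplification coins `Z`; the error bit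
  `errBit` compares the candidate's vote with the label — and counts the errors (`errCount`, blocks `blockAt`);
* selects the first candidate whose count is at most the threshold `τ` (`passes`, `sel`) and answers with its
  vote on the padded input query, on a fresh output block (`outZ`, `out`).

This file fixes these definitions (parameters bundled in `Params`) and the structural facts used by the
analysis (`…AdviceElimCount/Rate.lean`) and the machine (`…AdviceElimMachineA/B.lean`): `out_take`, `out_append`,
`errCount_eq_nbad` (`BPPAmp.nbad`), and the error of the majority vote AT THE TRUE BUDGET
(`uniformProb_maj_ne_le_exp`, Hoeffding via `BPPAmp.uniformProb_le_of_nbad`).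
References: Bogdanov–Trevisan (2006), Def. 2.12–2.13, Lemma 3.2; Arora–Barak (2009), §7.4.1, Thm. 7.10;
Impagliazzo–Wigderson, JCSS 63 (2001), Lemma 14 (selection by testing).
-/

noncomputable section

open _root_.Computability
open Literature.Computability.Complexity Literature.Computability.MetaComplexity
open Finset

namespace Summit.PneNP.PneNP.Cruxes.PeaWorstToAvg.DualModeCompile

set_option linter.dupNamespace false -- `Summit.PneNP.PneNP.…`: summit = sub-problem name (D-0017 single-conjunct layout)

namespace AdviceElim

/-! ### Parameters -/

/-- The integer parameters of one run of the uniform scheme on an input `(y, 1ⁿ, 1ᵐ)`: the distribution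
parameter `n`, the samplers' coin budget `cn = c(n)`, the common padded query length `G`, the largest
candidate budget `P`, the number `k` of repetitions of the majority vote, the number `N` of labelled samples
per candidate and the pass threshold `τ`. [BogdanovTrevisan2006, Def. 2.12] -/
structure Params where
  /-- distribution parameter `n` -/
  n : ℕ
  /-- the samplers' coin budget `c(n)` -/
  cn : ℕ
  /-- the common padded query length `G` -/
  G : ℕ
  /-- the largest candidate budget `P` (candidates `0, …, P`) -/
  P : ℕ
  /-- repetitions of the majority vote `k` -/
  k : ℕ
  /-- labelled samples per candidate `N` -/
  N : ℕ
  /-- pass threshold `τ` on the empirical error count -/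
  τ : ℕ

namespace Params

variable (pm : Params)

/-- Length of a sample block: one label bit, `c(n)` sampler coins, `k · P` amplification coins. [folklore] -/
def L : ℕ := 1 + pm.cn + pm.k * pm.P

/-- Length of the test region: `P + 1` candidates, `N` blocks each. [folklore] -/
def testLen : ℕ := (pm.P + 1) * pm.N * pm.L

/-- Number of coins actually read: the test region and the output block of `k · P` coins. [folklore] -/
def total : ℕ := pm.testLen + pm.k * pm.P

end Params

/-! ### Padded queries -/

/-- The padded failure parameter `m'(y) = G − |⟨y, ⟨1ⁿ, 1⁰⟩⟩|` (the device of
`exists_padded_simulator`). [BogdanovTrevisan2006, Lemma 3.2 (proof)] -/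
def padM (G n : ℕ) (y : List Bool) : ℕ := G - (schemeEnc (y, n, 0)).length

/-- The padded query `(y, 1ⁿ, 1^{m'(y)})`. [BogdanovTrevisan2006, Lemma 3.2 (proof)] -/
def query (G n : ℕ) (y : List Bool) : List Bool × ℕ × ℕ := (y, n, padM G n y)

/-- All padded queries of short instances have length exactly `G`. [folklore] -/
theorem length_schemeEnc_query {G n : ℕ} {y : List Bool} (h : (schemeEnc (y, n, 0)).length ≤ G) :
    (schemeEnc (query G n y)).length = G := by
  unfold query padM
  simp only [length_schemeEnc] at h ⊢
  omega

/-! ### Reading blocks of a prefix -/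

/-- A window inside the first `K` coins is read off the prefix of length `K`. [folklore] -/
theorem drop_take_take_of_le {R : List Bool} {a b K : ℕ} (h : a + b ≤ K) :
    ((R.take K).drop a).take b = (R.drop a).take b := by
  rw [List.drop_take, List.take_take, Nat.min_eq_left (by omega)]

/-! ### The majority vote of a candidate budget -/

variable (A : RandAlg (List Bool × ℕ × ℕ) Bool)

/-- The number of accepting runs among `k` runs of `A` on the query `q`, run `j` reading the `c` coins
`Z[jc, jc + c)`. [AroraBarak2009, Thm. 7.10 (proof)] -/
def votes (q : List Bool × ℕ × ℕ) (c k : ℕ) (Z : List Bool) : ℕ :=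
  ∑ j ∈ range k, (A.run q ((Z.drop (j * c)).take c)).toNat

/-- The majority verdict of candidate budget `c`: `[k < 2 · votes]`. [AroraBarak2009, Thm. 7.10 (proof)] -/
def maj (q : List Bool × ℕ × ℕ) (c k : ℕ) (Z : List Bool) : Bool :=
  decide (k < 2 * votes A q c k Z)

/-- The vote reads only the first `k · c` coins. [folklore] -/
theorem votes_take {q : List Bool × ℕ × ℕ} {c k K : ℕ} (h : k * c ≤ K) (Z : List Bool) :
    votes A q c k (Z.take K) = votes A q c k Z := by
  unfold votes
  refine sum_congr rfl fun j hj => ?_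
  have hj : j + 1 ≤ k := mem_range.1 hj
  have hle : j * c + c ≤ K :=
    le_trans (by simpa [Nat.succ_mul] using Nat.mul_le_mul_right c hj) h
  rw [drop_take_take_of_le hle]

/-- The majority verdict reads only the first `k · c` coins. [folklore] -/
theorem maj_take {q : List Bool × ℕ × ℕ} {c k K : ℕ} (h : k * c ≤ K) (Z : List Bool) :
    maj A q c k (Z.take K) = maj A q c k Z := by
  unfold maj
  rw [votes_take A h]

/-- **A wrong majority needs half the runs wrong.** [AroraBarak2009, Thm. 7.10 (proof)] -/
theorem le_two_mul_nbad_of_maj_ne {q : List Bool × ℕ × ℕ} {c k : ℕ} {Z : List Bool} {lab : Bool}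
    (h : maj A q c k Z ≠ lab) : k ≤ 2 * BPPAmp.nbad k c {u | A.run q u ≠ lab} Z := by
  unfold maj at h
  cases lab
  · have hv : BPPAmp.nbad k c {u | A.run q u ≠ false} Z = votes A q c k Z := by
      unfold votes BPPAmp.nbad BPPAmp.block
      refine sum_congr rfl fun j _ => ?_
      simp only [Set.mem_setOf_eq]
      by_cases hr : A.run q ((Z.drop (j * c)).take c) = true <;> simp [hr]
    rw [hv]
    have : k < 2 * votes A q c k Z := by simpa using h
    omega
  · have hv : BPPAmp.nbad k c {u | A.run q u ≠ true} Z + votes A q c k Z = k := by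
      unfold votes BPPAmp.nbad BPPAmp.block
      rw [← sum_add_distrib, sum_const_nat (m := 1) fun j _ => ?_, card_range, mul_one]
      simp only [Set.mem_setOf_eq]
      by_cases hr : A.run q ((Z.drop (j * c)).take c) = true <;> simp [hr]
    have : ¬ k < 2 * votes A q c k Z := by simpa using h
    omega

/-- **Error of the majority vote of `k` runs** with `c` coins each, when a single run errs with
probability `≤ 1/4`: at most `exp(−k/32)` (Hoeffding, `BPPAmp.uniformProb_le_of_nbad`).
[AroraBarak2009, Thm. 7.10 (proof: "the Chernoff bound")] -/
theorem uniformProb_maj_ne_le {q : List Bool × ℕ × ℕ} {c k : ℕ} {lab : Bool} (hk : 0 < k)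
    (he : uniformProb c {u | A.run q u ≠ lab} ≤ 1 / 4) :
    uniformProb (k * c) {Z | maj A q c k Z ≠ lab} ≤ Real.exp (-(k / 32 : ℝ)) :=
  BPPAmp.uniformProb_le_of_nbad {u | A.run q u ≠ lab} _ hk
    (fun _ _ hZ => le_two_mul_nbad_of_maj_ne A hZ) he

/-- The same over a longer coin block `k · P' ≥ k · c` (the vote reads a prefix, `maj_take`). [folklore] -/
theorem uniformProb_maj_ne_le' {q : List Bool × ℕ × ℕ} {c k P' : ℕ} {lab : Bool} (hk : 0 < k)
    (hc : c ≤ P') (he : uniformProb c {u | A.run q u ≠ lab} ≤ 1 / 4) :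
    uniformProb (k * P') {Z | maj A q c k Z ≠ lab} ≤ Real.exp (-(k / 32 : ℝ)) := by
  have hset : {Z : List Bool | maj A q c k Z ≠ lab} =
      {Z | Z.take (k * c) ∈ {Z' : List Bool | maj A q c k Z' ≠ lab}} := by
    ext Z
    simp only [Set.mem_setOf_eq, maj_take A le_rfl]
  rw [hset, uniformProb_take_of_le (Nat.mul_le_mul_left k hc)]
  exact uniformProb_maj_ne_le A hk he

/-- The error probability of `A` on a padded query of a short instance is a counting probability over
`coinLen_A G` coins — the SAME number for all short instances. [BogdanovTrevisan2006, Lemma 3.2 (proof)] -/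
theorem pr_query_eq {G n : ℕ} {y : List Bool} (h : (schemeEnc (y, n, 0)).length ≤ G) (E : Set Bool) :
    A.pr schemeEnc (query G n y) E = uniformProb (A.coinLen G) {u | A.run (query G n y) u ∈ E} := by
  rw [RandAlg.pr_eq_uniformProb, length_schemeEnc_query h]

/-- **The majority vote at the TRUE budget `c⋆ = coinLen_A G`** errs with probability `≤ exp(−k/32)` over a
fresh block of `k · P ≥ k · c⋆` coins, on every short instance on which `A` errs with probability `< 1/4`.
[AroraBarak2009, Thm. 7.10; BogdanovTrevisan2006, Def. 2.12 (amplification)] -/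
theorem uniformProb_maj_ne_le_exp {G n k P : ℕ} {y : List Bool} {lab : Bool} (hk : 0 < k)
    (hG : (schemeEnc (y, n, 0)).length ≤ G) (hP : A.coinLen G ≤ P)
    (hgood : A.pr schemeEnc (query G n y) {b | b ≠ lab} < 1 / 4) :
    uniformProb (k * P) {Z | maj A (query G n y) (A.coinLen G) k Z ≠ lab} ≤ Real.exp (-(k / 32 : ℝ)) := by
  rw [pr_query_eq A hG] at hgood
  exact uniformProb_maj_ne_le' A hk hP hgood.le

/-! ### Labelled samples, error counts, selection, output -/

variable (S : Bool → RandAlg ℕ (List Bool))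

/-- The instance of a sample block `b · r · Z`: `S_b(1ⁿ; r)` with `r` the `c(n)` coins after the label bit
`b` (the label of the instance: `S_false` samples NO instances, `S_true` YES instances).
[BogdanovTrevisan2006, Def. 2.1] -/
def inst (n cn : ℕ) (blk : List Bool) : List Bool :=
  (S (blk.headD false)).run n ((blk.drop 1).take cn)

/-- The error bit of candidate `c` on a sample block: its majority vote on the padded query of the sampled
instance, with the block's amplification coins, differs from the label.
[ImpagliazzoWigderson2001, Lemma 14 (proof: "estimate … by sampling")] -/
def errBit (pm : Params) (c : ℕ) (blk : List Bool) : Bool :=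
  decide (maj A (query pm.G pm.n (inst S pm.n pm.cn blk)) c pm.k (blk.drop (1 + pm.cn)) ≠ blk.headD false)

/-- Sample block `i` of candidate `c`: the coins `[(cN + i) L, (cN + i) L + L)`. [folklore] -/
def blockAt (pm : Params) (c i : ℕ) (R : List Bool) : List Bool :=
  (R.drop ((c * pm.N + i) * pm.L)).take pm.L

/-- The empirical error count of candidate `c` on its `N` sample blocks.
[ImpagliazzoWigderson2001, Lemma 14 (proof)] -/
def errCount (pm : Params) (c : ℕ) (R : List Bool) : ℕ :=
  ∑ i ∈ range pm.N, (errBit A S pm c (blockAt pm c i R)).toNat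

/-- Candidate `c` passes the test: error count at most `τ`. [ImpagliazzoWigderson2001, Lemma 14 (proof)] -/
def passes (pm : Params) (R : List Bool) (c : ℕ) : Bool :=
  decide (errCount A S pm c R ≤ pm.τ)

/-- The selected candidate: the least passing `c ≤ P`, if any. [ImpagliazzoWigderson2001, Lemma 14 (proof)] -/
def sel (pm : Params) (R : List Bool) : Option ℕ :=
  (List.range (pm.P + 1)).find? (passes A S pm R)

/-- The output block: the `k · P` coins after the test region. [folklore] -/
def outZ (pm : Params) (R : List Bool) : List Bool :=
  (R.drop pm.testLen).take (pm.k * pm.P)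

/-- **The answer of the uniform scheme** on instance `y` with coins `R`: the majority vote of the selected
candidate on the padded query of `y`, over the output block (`false` if no candidate passes).
[BogdanovTrevisan2006, Def. 2.12–2.13; ImpagliazzoWigderson2001, Lemma 14] -/
def out (pm : Params) (y R : List Bool) : Bool :=
  match sel A S pm R with
  | some c => maj A (query pm.G pm.n y) c pm.k (outZ pm R)
  | none => false

variable {A S}

/-- A selected candidate is at most `P` and passes. [folklore] -/
theorem sel_eq_some {pm : Params} {R : List Bool} {c : ℕ} (h : sel A S pm R = some c) :
    c ≤ pm.P ∧ passes A S pm R c = true :=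
  ⟨Nat.lt_succ_iff.1 (List.mem_range.1 (List.mem_of_find?_eq_some h)), List.find?_some h⟩

/-- If some candidate `c ≤ P` passes, a candidate is selected. [folklore] -/
theorem sel_ne_none {pm : Params} {R : List Bool} {c : ℕ} (hc : c ≤ pm.P)
    (hp : passes A S pm R c = true) : sel A S pm R ≠ none := by
  intro h
  rw [sel, List.find?_eq_none] at h
  exact h c (List.mem_range.2 (Nat.lt_succ_of_le hc)) hp

/-- `find?` only depends on the predicate on the list. [folklore] -/
theorem find?_congr_of_forall {α : Type*} {p p' : α → Bool} :
    ∀ {l : List α}, (∀ x ∈ l, p x = p' x) → l.find? p = l.find? p'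
  | [], _ => rfl
  | a :: l, h => by
    rw [List.find?_cons, List.find?_cons, h a (by simp),
      find?_congr_of_forall fun x hx => h x (List.mem_cons_of_mem a hx)]

/-- The sample blocks lie inside the test region. [folklore] -/
theorem blockAt_end_le {pm : Params} {c i : ℕ} (hc : c ≤ pm.P) (hi : i < pm.N) :
    (c * pm.N + i) * pm.L + pm.L ≤ pm.testLen := by
  unfold Params.testLen
  have h1 : (c * pm.N + i) * pm.L + pm.L = (c * pm.N + i + 1) * pm.L := by ring
  have h2 : c * pm.N + i + 1 ≤ (pm.P + 1) * pm.N := by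
    have : (c + 1) * pm.N ≤ (pm.P + 1) * pm.N := Nat.mul_le_mul_right _ (by omega)
    rw [Nat.succ_mul] at this
    omega
  rw [h1]
  exact Nat.mul_le_mul_right _ h2

/-! #### Reading a prefix -/

/-- Blocks are read off a long enough prefix. [folklore] -/
theorem blockAt_take {pm : Params} {c i K : ℕ} (h : (c * pm.N + i) * pm.L + pm.L ≤ K) (R : List Bool) :
    blockAt pm c i (R.take K) = blockAt pm c i R :=
  drop_take_take_of_le h

/-- Error counts are read off the test region. [folklore] -/
theorem errCount_take {pm : Params} {c K : ℕ} (hc : c ≤ pm.P) (hK : pm.testLen ≤ K) (R : List Bool) :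
    errCount A S pm c (R.take K) = errCount A S pm c R :=
  sum_congr rfl fun i hi => by rw [blockAt_take ((blockAt_end_le hc (mem_range.1 hi)).trans hK)]

/-- The selection is read off the test region. [folklore] -/
theorem sel_take {pm : Params} {K : ℕ} (hK : pm.testLen ≤ K) (R : List Bool) :
    sel A S pm (R.take K) = sel A S pm R :=
  find?_congr_of_forall fun c hc => by
    unfold passes
    rw [errCount_take (Nat.lt_succ_iff.1 (List.mem_range.1 hc)) hK]

/-- The output block is read off the first `total` coins. [folklore] -/
theorem outZ_take (pm : Params) (R : List Bool) : outZ pm (R.take pm.total) = outZ pm R :=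
  drop_take_take_of_le le_rfl

/-- **The answer depends only on the first `total` coins.** [folklore] -/
theorem out_take (pm : Params) (y R : List Bool) : out A S pm y (R.take pm.total) = out A S pm y R := by
  have hK : pm.testLen ≤ pm.total := Nat.le_add_right _ _
  unfold out
  rw [sel_take (A := A) (S := S) hK R, outZ_take]

/-! #### Splitting the coins into the test region and the output block -/

/-- Blocks are read off the test region `t` of `t ++ z`. [folklore] -/
theorem blockAt_append {pm : Params} {c i : ℕ} {t : List Bool} (ht : t.length = pm.testLen) (hc : c ≤ pm.P)
    (hi : i < pm.N) (z : List Bool) : blockAt pm c i (t ++ z) = blockAt pm c i t := by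
  unfold blockAt
  have h := blockAt_end_le hc hi
  rw [List.drop_append_of_le_length (by omega),
    List.take_append_of_le_length (by rw [List.length_drop]; omega)]

/-- Error counts are read off the test region. [folklore] -/
theorem errCount_append {pm : Params} {c : ℕ} {t : List Bool} (ht : t.length = pm.testLen) (hc : c ≤ pm.P)
    (z : List Bool) : errCount A S pm c (t ++ z) = errCount A S pm c t :=
  sum_congr rfl fun i hi => by rw [blockAt_append ht hc (mem_range.1 hi)]

/-- The selection is read off the test region. [folklore] -/
theorem sel_append {pm : Params} {t : List Bool} (ht : t.length = pm.testLen) (z : List Bool) :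
    sel A S pm (t ++ z) = sel A S pm t :=
  find?_congr_of_forall fun c hc => by
    unfold passes
    rw [errCount_append ht (Nat.lt_succ_iff.1 (List.mem_range.1 hc))]

/-- The output block of `t ++ z` is (a prefix of) `z`. [folklore] -/
theorem outZ_append {pm : Params} {t : List Bool} (ht : t.length = pm.testLen) (z : List Bool) :
    outZ pm (t ++ z) = z.take (pm.k * pm.P) := by
  unfold outZ
  rw [← ht, List.drop_left]

/-- **The answer on `t ++ z`**: the selected candidate of the test region `t` votes on `z`. [folklore] -/
theorem out_append {pm : Params} {t : List Bool} (ht : t.length = pm.testLen) (y z : List Bool) :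
    out A S pm y (t ++ z) =
      match sel A S pm t with
      | some c => maj A (query pm.G pm.n y) c pm.k (z.take (pm.k * pm.P))
      | none => false := by
  unfold out
  rw [sel_append ht, outZ_append ht]

/-! #### The error count as a block count -/

/-- The segment of the test region holding the `N` blocks of candidate `c`. [folklore] -/
def segment (pm : Params) (c : ℕ) (t : List Bool) : List Bool :=
  (t.drop (c * pm.N * pm.L)).take (pm.N * pm.L)

/-- Block `i < N` of the segment of `c` is sample block `(c, i)`. [folklore] -/
theorem block_segment {pm : Params} {i : ℕ} (hi : i < pm.N) (c : ℕ) (t : List Bool) :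
    BPPAmp.block pm.L i (segment pm c t) = blockAt pm c i t := by
  unfold BPPAmp.block segment blockAt
  rw [List.drop_take, List.take_take, List.drop_drop]
  have hmin : min pm.L (pm.N * pm.L - i * pm.L) = pm.L := by
    refine Nat.min_eq_left ?_
    have : (i + 1) * pm.L ≤ pm.N * pm.L := Nat.mul_le_mul_right _ hi
    rw [Nat.succ_mul] at this
    omega
  rw [hmin, show c * pm.N * pm.L + i * pm.L = (c * pm.N + i) * pm.L by ring]

/-- **The empirical error count is the number of blocks of the segment lying in the error event**
(`BPPAmp.nbad`). [folklore] -/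
theorem errCount_eq_nbad (pm : Params) (c : ℕ) (t : List Bool) :
    errCount A S pm c t = BPPAmp.nbad pm.N pm.L {blk | errBit A S pm c blk = true} (segment pm c t) := by
  unfold errCount BPPAmp.nbad
  refine sum_congr rfl fun i hi => ?_
  rw [block_segment (mem_range.1 hi)]
  simp only [Set.mem_setOf_eq]
  by_cases hb : errBit A S pm c (blockAt pm c i t) = true <;> simp [hb]

/-- The segments lie inside the test region: `cNL + (NL + rest) = testLen` for `c ≤ P`. [folklore] -/
theorem segment_split {pm : Params} {c : ℕ} (hc : c ≤ pm.P) :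
    c * pm.N * pm.L + (pm.N * pm.L + (pm.P - c) * pm.N * pm.L) = pm.testLen := by
  unfold Params.testLen
  obtain ⟨d, hd⟩ := Nat.exists_eq_add_of_le hc
  rw [hd, Nat.add_sub_cancel_left]
  ring

/-- **The event "candidate `c` passes / fails" as a cylinder over its segment**: for any property `F` of
the segment, `Pr_t[segment_c t ∈ F] = Pr_{s ∈ {0,1}^{NL}}[s ∈ F]`. [AroraBarak2009, §7.1] -/
theorem uniformProb_segment {pm : Params} {c : ℕ} (hc : c ≤ pm.P) (F : Set (List Bool)) :
    uniformProb pm.testLen {t | segment pm c t ∈ F} = uniformProb (pm.N * pm.L) F := by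
  rw [uniformProb_eq_cnt_div, uniformProb_eq_cnt_div, ← segment_split hc]
  unfold segment
  rw [cnt_drop_take]
  rw [pow_add, pow_add]
  push_cast
  have h1 : (0 : ℝ) < 2 ^ (c * pm.N * pm.L) := by positivity
  have h2 : (0 : ℝ) < 2 ^ ((pm.P - c) * pm.N * pm.L) := by positivity
  field_simp

end AdviceElim

/-- **Registered sub-goal of this file**: the majority vote at the true budget errs with probability
`≤ exp(−k/32)` on every short instance that is good for `A` (`AdviceElim.uniformProb_maj_ne_le_exp`).
[AroraBarak2009, Thm. 7.10; BogdanovTrevisan2006, Def. 2.12] -/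
theorem adviceElim_maj_true_budget (A : RandAlg (List Bool × ℕ × ℕ) Bool) {G n k P : ℕ} {y : List Bool}
    {lab : Bool} (hk : 0 < k) (hG : (schemeEnc (y, n, 0)).length ≤ G) (hP : A.coinLen G ≤ P)
    (hgood : A.pr schemeEnc (AdviceElim.query G n y) {b | b ≠ lab} < 1 / 4) :
    uniformProb (k * P) {Z | AdviceElim.maj A (AdviceElim.query G n y) (A.coinLen G) k Z ≠ lab} ≤
      Real.exp (-(k / 32 : ℝ)) :=
  AdviceElim.uniformProb_maj_ne_le_exp A hk hG hP hgood

end Summit.PneNP.PneNP.Cruxes.PeaWorstToAvg.DualModeCompile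

end
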